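import Summits.Ventures.HodgeRepro2.BallQuotientFiniteCover
import Summits.Ventures.HodgeRepro2.BallQuotientHausdorff

/-!
# Compactness of `Γ\𝔹²` passes to subgroups of finite index

Kernel support for the blind cell pub-hodge-repro2 (seat p2), T5-ID §ID-4(b′) / the Tier-3 hypothesis
shapes of `Hypothesis.lean`: if `S\𝔹²` is compact and `S' ≤ S` has finite index, then `S'\𝔹²` is
compact.  Proof: a compact quotient is the image of a compact subset `C ⊆ 𝔹²` (local compactness of the
ball + a finite subcover of the open quotient map); with right-coset representatives `r₁, …, r_n` of
`S'` in `S`, the compact set `C' := ⋃ r_i⁻¹ • C` satisfies `S' • C' = S • C = 𝔹²`, so `S'\𝔹²` is the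
continuous image of `C'`.  Consequently the single arithmetic hypothesis «`Γ₁\𝔹²` compact» (the
anisotropy of `H`) gives compact quotients for all congruence subgroups.
-/

namespace Summit.Ventures.HodgeRepro2.ShimuraData

open scoped Pointwise

variable {K : Type*} [Field K] [NumberField K] [NumberField.IsCMField K]
    {τ₁ : K →+* ℂ} {H : Matrix (Fin 3) (Fin 3) K} {Q : Matrix (Fin 3) (Fin 3) ℂ}
    (hQ : IsFrame K τ₁ H Q)

/-- A compact quotient `S\𝔹²` is the image of a compact subset of the ball. -/
theorem exists_isCompact_image_mk_eq_univ (S : Subgroup (GL (Fin 3) K))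
    (hS : (S : Set (GL (Fin 3) K)) ⊆ unitaryGroup K H) [CompactSpace (ballQuotient hQ S hS)] :
    ∃ C : Set ball₂, IsCompact C ∧ ballQuotient.mk hQ S hS '' C = Set.univ := by
  haveI : LocallyCompactSpace ball₂ := locallyCompactSpace_ball₂
  choose Kz hKzc hKz using fun z : ball₂ => exists_compact_mem_nhds z
  have hcov : (Set.univ : Set (ballQuotient hQ S hS)) ⊆
      ⋃ z, ballQuotient.mk hQ S hS '' interior (Kz z) := by
    intro x _
    obtain ⟨z, rfl⟩ := ballQuotient_mk_surjective hQ S hS x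
    exact Set.mem_iUnion.mpr ⟨z, z, mem_interior_iff_mem_nhds.mpr (hKz z), rfl⟩
  obtain ⟨T, hT⟩ := isCompact_univ.elim_finite_subcover _
    (fun z => (isOpenQuotientMap_ballQuotient_mk hQ S hS).isOpenMap _ isOpen_interior) hcov
  refine ⟨⋃ z ∈ T, Kz z, T.isCompact_biUnion fun z _ => hKzc z, ?_⟩
  refine Set.eq_univ_of_univ_subset fun x hx => ?_
  obtain ⟨z, hzT, w, hw, rfl⟩ := Set.mem_iUnion₂.mp (hT hx)
  exact ⟨w, Set.mem_iUnion₂.mpr ⟨z, hzT, interior_subset hw⟩, rfl⟩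

/-- **Compactness passes to finite-index subgroups**: if `S\𝔹²` is compact and `S' ≤ S` has finite
index, then `S'\𝔹²` is compact. -/
theorem compactSpace_ballQuotient_of_le {S' S : Subgroup (GL (Fin 3) K)} (hS'S : S' ≤ S)
    (hS : (S : Set (GL (Fin 3) K)) ⊆ unitaryGroup K H) [hfi : (S'.subgroupOf S).FiniteIndex]
    [CompactSpace (ballQuotient hQ S hS)] :
    CompactSpace (ballQuotient hQ S' (fun _ hγ => hS (hS'S hγ))) := by
  letI := frameAction hQ S hS
  haveI : ContinuousConstSMul S ball₂ := continuousConstSMul_frameAction hQ S hS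
  haveI : Finite (S ⧸ S'.subgroupOf S) := Subgroup.finite_quotient_of_finiteIndex
  obtain ⟨C, hC, hCu⟩ := exists_isCompact_image_mk_eq_univ hQ S hS
  -- the compact set `C' := ⋃ q, (q.out)⁻¹ • C` over the cosets of `S'` in `S`
  let C' : Set ball₂ := ⋃ q : S ⧸ S'.subgroupOf S, (Quotient.out q)⁻¹ • C
  have hC' : IsCompact C' := isCompact_iUnion fun q => hC.smul _
  rw [← isCompact_univ_iff]
  have hS'u : ∀ γ ∈ S', γ ∈ unitaryGroup K H := fun _ hγ => hS (hS'S hγ)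
  suffices hsuff : ballQuotient.mk hQ S' hS'u '' C' = Set.univ by
    rw [← hsuff]
    exact hC'.image (isOpenQuotientMap_ballQuotient_mk hQ S' hS'u).continuous
  refine Set.eq_univ_of_univ_subset fun x _ => ?_
  obtain ⟨z, rfl⟩ := ballQuotient_mk_surjective hQ S' hS'u x
  -- `z = s • c` for some `s ∈ S`, `c ∈ C`
  have hz : ballQuotient.mk hQ S hS z ∈ ballQuotient.mk hQ S hS '' C := by
    rw [hCu]; exact Set.mem_univ _
  obtain ⟨c, hc, hcz⟩ := hz
  obtain ⟨s, hs⟩ := (ballQuotient_mk_eq_mk_iff hQ S hS c z).mp hcz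
  -- `s • z = c` in the subtype
  have hsz : s • z = c := Subtype.ext (by rw [frameAction_smul_coe]; exact hs)
  -- coset representative: `out ⟦s⟧ = s * t` with `t ∈ S'`, so `z = s⁻¹ • c = t • ((out ⟦s⟧)⁻¹ • c)`
  set q : S ⧸ S'.subgroupOf S := QuotientGroup.mk s with hq
  obtain ⟨t, ht⟩ := QuotientGroup.mk_out_eq_mul (S'.subgroupOf S) s
  have ht' : ((t : S) : GL (Fin 3) K) ∈ S' := Subgroup.mem_subgroupOf.mp t.property
  set w : ball₂ := (Quotient.out q)⁻¹ • c with hw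
  have hzw : z = (t : S) • w := by
    rw [hw, hq, ht, mul_inv_rev, mul_smul, smul_inv_smul, ← hsz, inv_smul_smul]
  refine ⟨w, Set.mem_iUnion.mpr ⟨q, c, hc, rfl⟩, ?_⟩
  refine (ballQuotient_mk_eq_mk_iff hQ S' hS'u w z).mpr
    ⟨⟨((t : S) : GL (Fin 3) K)⁻¹, S'.inv_mem ht'⟩, ?_⟩
  have key : ballAction (realEmbedding K τ₁ Q (((t : S)⁻¹ : S) : GL (Fin 3) K)) (z : Fin 2 → ℂ) =
      (((t : S)⁻¹ • z : ball₂) : Fin 2 → ℂ) := (frameAction_smul_coe hQ S hS (t : S)⁻¹ z).symm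
  rw [Subgroup.coe_inv] at key
  show ballAction (realEmbedding K τ₁ Q ((t : S) : GL (Fin 3) K)⁻¹) (z : Fin 2 → ℂ) = (w : Fin 2 → ℂ)
  rw [key, hzw, inv_smul_smul]

end Summit.Ventures.HodgeRepro2.ShimuraData
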